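import Summits.QuantumFields.QCD.Theorems.PauliWegnerSeaFMClosureUnquenchedDefs
import Literature.MathematicalPhysics.QuantumFieldTheory.QCDPhaseQuenchedPositivity
import Mathlib.Probability.ProductMeasure

/-!
# Crux `FMClosureUnquenched` (stmt-QuantumFields-11512), line `von-mises-circles`, stub `stub_twoStar` —
helper 3: conditioning on a fibre and the phase-quenched quotient

Measure-theoretic glue for the two-star package (`TwoStarBounds`, clauses (T0), (T5), (Tdec), (T1)):

* `lintegral_refit_eq_lmarginal` — for a finite product `μ^{⊗ι}` of a probability measure and a set `R` of free
  coordinates, `∫ f(refit_R U W) dμ^{⊗ι}(W)` (outside frozen to `U`, `refit_R U W = if · ∈ R then W else U`) is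
  Mathlib's marginal `∫⋯∫⁻_R f` at `U`; hence (`lintegral_le_of_forall_refit_le`) a bound
  `∫ f ∘ refit_R U ≤ K ∫ g ∘ refit_R U` valid on EVERY fibre integrates to `∫ f ≤ K ∫ g` (tower property,
  `MeasureTheory.lintegral_le_of_lmarginal_le`).
* `lintegral_wilsonMeasure_eq` — `∫ h dμ_W(β) = Z⁻¹ ∫ e^{-βS} h dHaar`, and the transfer of fibre bounds to the
  quotient `pqE = ∫ |det 𝔇| F dμ_W / ∫ |det 𝔇| dμ_W` (`pqE_le_of_fibre_bound`, `pqE_le_mul_pqE_of_fibre_bound`,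
  `integrable_of_fibre_bound`), the denominator being positive (`integral_norm_det_diracMatrix_pos_all`).
* `lintegral_ofReal_mul_le_of_div_le` — a normalised Bochner bound `∫ g w / ∫ w ≤ B` (the form of (Flat)/(Neg) in
  `FibreBandLaw`) as the un-normalised `lintegral` bound `∫ g w ≤ B ∫ w` (junk-safe at `∫ w = 0`).

References: Aizenman–Schenker–Friedrich–Hundertmark, CMP 224 (2001) 219, §2 (conditioning on the two stars)
[AizenmanEtAl2001]; the measure theory is standard [folklore].
-/

noncomputable section

open scoped BigOperators ENNReal
open MeasureTheory
open Literature.MathematicalPhysics.QuantumFieldTheory Literature.MathematicalPhysics.QuantumLattice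
  Literature.Probability.LatticeModels
open Summit.QuantumFields.QCD.Theorems.VonMisesCircles

namespace Summit.QuantumFields.QCD.Theorems.VonMisesCirclesC1

/-! ## Refitting a fibre: the tower property -/

section Refit

variable {ι α : Type*} [Fintype ι] [DecidableEq ι] [MeasurableSpace α]

omit [Fintype ι] in
/-- Refitting the coordinates in `R` is measurable in the free coordinates. [folklore] -/
theorem measurable_refit_pi (R : Finset ι) (U : ι → α) :
    Measurable fun W : ι → α => (fun i => if i ∈ R then W i else U i : ι → α) := by
  refine measurable_pi_lambda _ fun i => ?_
  by_cases hi : i ∈ R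
  · simp only [hi, if_true]; exact measurable_pi_apply i
  · simp only [hi, if_false]; exact measurable_const

/-- **Fibre integral = marginal.**  Integrating `f` over the free coordinates `R` with the others frozen to `U`
is Mathlib's `lmarginal` of `f` on `R` evaluated at `U` (the frozen coordinates of the integration variable
integrate out because `μ` is a probability measure). [folklore] -/
theorem lintegral_refit_eq_lmarginal (μ : Measure α) [IsProbabilityMeasure μ] (R : Finset ι)
    {f : (ι → α) → ℝ≥0∞} (hf : Measurable f) (U : ι → α) :
    ∫⁻ W, f (fun i => if i ∈ R then W i else U i) ∂(Measure.pi fun _ : ι => μ) =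
      (∫⋯∫⁻_R, f ∂(fun _ : ι => μ)) U := by
  have hmp : MeasurePreserving (R.restrict (π := fun _ : ι => α)) (Measure.pi fun _ : ι => μ)
      (Measure.pi fun _ : ↥R => μ) := by
    refine ⟨Finset.measurable_restrict R, ?_⟩
    rw [← Measure.infinitePi_eq_pi, Measure.infinitePi_map_restrict]
  have hupd : ∀ W : ι → α, (fun i => if i ∈ R then W i else U i) =
      Function.updateFinset U R (R.restrict W) := by
    intro W
    funext i
    simp only [Function.updateFinset, Finset.restrict]
    by_cases hi : i ∈ R
    · rw [if_pos hi, dif_pos hi]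
    · rw [if_neg hi, dif_neg hi]
  simp_rw [hupd]
  exact hmp.lintegral_comp (hf.comp measurable_updateFinset)

/-- **Tower property, inequality form.**  A bound `∫ f ∘ refit ≤ K ∫ g ∘ refit` valid on every fibre
integrates to `∫ f ≤ K ∫ g`. [folklore] -/
theorem lintegral_le_of_forall_refit_le (μ : Measure α) [IsProbabilityMeasure μ] (R : Finset ι)
    {f g : (ι → α) → ℝ≥0∞} (hf : Measurable f) (hg : Measurable g) (K : ℝ≥0∞)
    (h : ∀ U : ι → α,
      ∫⁻ W, f (fun i => if i ∈ R then W i else U i) ∂(Measure.pi fun _ : ι => μ) ≤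
        K * ∫⁻ W, g (fun i => if i ∈ R then W i else U i) ∂(Measure.pi fun _ : ι => μ)) :
    ∫⁻ W, f W ∂(Measure.pi fun _ : ι => μ) ≤ K * ∫⁻ W, g W ∂(Measure.pi fun _ : ι => μ) := by
  rw [← lintegral_const_mul _ hg]
  refine lintegral_le_of_lmarginal_le (μ := fun _ : ι => μ) R hf (hg.const_mul K) fun U => ?_
  rw [← lintegral_refit_eq_lmarginal μ R hf U, ← lintegral_refit_eq_lmarginal μ R (hg.const_mul K) U]
  refine (h U).trans_eq ?_
  exact (lintegral_const_mul K (hg.comp (measurable_refit_pi R U))).symm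

end Refit

/-! ## Normalised Bochner bounds as `lintegral` bounds -/

section Quotient

variable {Ω : Type*} [MeasurableSpace Ω]

/-- A normalised bound `∫ g w / ∫ w ≤ B` (`w ≥ 0` integrable, `g ≥ 0`, `g w` integrable) in un-normalised
`lintegral` form `∫ g w ≤ B ∫ w`; at `∫ w = 0` both sides vanish. [folklore] -/
theorem lintegral_ofReal_mul_le_of_div_le (μ : Measure Ω) {w g : Ω → ℝ} (hw0 : ∀ x, 0 ≤ w x)
    (hg0 : ∀ x, 0 ≤ g x) (hwi : Integrable w μ) (hgi : Integrable (fun x => g x * w x) μ) {B : ℝ}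
    (hB : 0 ≤ B) (h : (∫ x, g x * w x ∂μ) / (∫ x, w x ∂μ) ≤ B) :
    ∫⁻ x, ENNReal.ofReal (g x * w x) ∂μ ≤ ENNReal.ofReal B * ∫⁻ x, ENNReal.ofReal (w x) ∂μ := by
  rw [← ofReal_integral_eq_lintegral_ofReal hgi (ae_of_all _ fun x => mul_nonneg (hg0 x) (hw0 x)),
    ← ofReal_integral_eq_lintegral_ofReal hwi (ae_of_all _ hw0), ← ENNReal.ofReal_mul hB]
  refine ENNReal.ofReal_le_ofReal ?_
  have hZ0 : 0 ≤ ∫ x, w x ∂μ := integral_nonneg fun x => hw0 x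
  rcases hZ0.lt_or_eq with hZ | hZ
  · rwa [div_le_iff₀ hZ] at h
  · have hw : w =ᵐ[μ] 0 := (integral_eq_zero_iff_of_nonneg_ae (ae_of_all _ hw0) hwi).1 hZ.symm
    have h0 : ∫ x, g x * w x ∂μ = 0 :=
      integral_eq_zero_of_ae (hw.mono fun x hx => by simp [hx])
    rw [h0, ← hZ, mul_zero]

/-- A flatness bound `a ≤ B · (∫ g w / ∫ w)` for every value `a = g x₀` gives `a · ∫ w ≤ B ∫ g w`
(`w ≥ 0` integrable). [folklore] -/
theorem mul_integral_le_of_le_div (μ : Measure Ω) {w g : Ω → ℝ} (hw0 : ∀ x, 0 ≤ w x)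
    {a B : ℝ} (hB : 0 ≤ B) (hgw : 0 ≤ ∫ x, g x * w x ∂μ)
    (h : a ≤ B * ((∫ x, g x * w x ∂μ) / (∫ x, w x ∂μ))) :
    a * (∫ x, w x ∂μ) ≤ B * ∫ x, g x * w x ∂μ := by
  have hZ0 : 0 ≤ ∫ x, w x ∂μ := integral_nonneg fun x => hw0 x
  rcases hZ0.lt_or_eq with hZ | hZ
  · calc a * (∫ x, w x ∂μ) ≤ B * ((∫ x, g x * w x ∂μ) / (∫ x, w x ∂μ)) * (∫ x, w x ∂μ) :=
          mul_le_mul_of_nonneg_right h hZ.le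
      _ = B * ∫ x, g x * w x ∂μ := by rw [mul_assoc, div_mul_cancel₀ _ hZ.ne']
  · rw [← hZ, mul_zero]
    exact mul_nonneg hB hgw

end Quotient

/-! ## The Wilson measure and the phase-quenched quotient -/

section Wilson

variable {Nf S : ℕ}

/-- `∫ h dμ_W(β) = Z(β)⁻¹ ∫ e^{-β S(U)} h(U) dHaar(U)` for the `SU(3)` Wilson measure of the four-torus. [folklore] -/
theorem lintegral_wilsonMeasure_eq (β : ℝ)
    (h : GaugeConfig 4 (2 * S + 1) (Matrix.specialUnitaryGroup (Fin 3) ℂ) → ℝ≥0∞) (hh : Measurable h) :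
    ∫⁻ U, h U ∂(wilsonMeasure (d := 4) (L := 2 * S + 1) (fundamentalRep (Fin 3)) β) =
      (partitionFunction (d := 4) (L := 2 * S + 1) (fundamentalRep (Fin 3)) β)⁻¹ *
        ∫⁻ U, ENNReal.ofReal (Real.exp (-β * wilsonAction (fundamentalRep (Fin 3)) U)) * h U
          ∂(Measure.pi fun _ : Edge 4 (2 * S + 1) => haarProbability (Matrix.specialUnitaryGroup (Fin 3) ℂ)) := by
  simp only [wilsonMeasure, lintegral_smul_measure, smul_eq_mul, wilsonWeight]
  rw [lintegral_withDensity_eq_lintegral_mul _ ?_ hh]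
  · rfl
  · exact (Real.measurable_exp.comp ((measurable_wilsonAction (d := 4) (L := 2 * S + 1)
      (fundamentalRep (Fin 3)) (continuous_fundamentalRep (Fin 3))).const_mul _)).ennreal_ofReal

/-- Transfer of a weighted-Haar bound to the Wilson measure: if `∫ e^{-βS} h₁ dHaar ≤ K ∫ e^{-βS} h₂ dHaar`
then `∫ h₁ dμ_W ≤ K ∫ h₂ dμ_W`. [folklore] -/
theorem lintegral_wilsonMeasure_le_of_haar_le (β : ℝ)
    (h₁ h₂ : GaugeConfig 4 (2 * S + 1) (Matrix.specialUnitaryGroup (Fin 3) ℂ) → ℝ≥0∞)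
    (hh₁ : Measurable h₁) (hh₂ : Measurable h₂) (K : ℝ≥0∞)
    (hle : ∫⁻ U, ENNReal.ofReal (Real.exp (-β * wilsonAction (fundamentalRep (Fin 3)) U)) * h₁ U
          ∂(Measure.pi fun _ : Edge 4 (2 * S + 1) => haarProbability (Matrix.specialUnitaryGroup (Fin 3) ℂ)) ≤
        K * ∫⁻ U, ENNReal.ofReal (Real.exp (-β * wilsonAction (fundamentalRep (Fin 3)) U)) * h₂ U
          ∂(Measure.pi fun _ : Edge 4 (2 * S + 1) => haarProbability (Matrix.specialUnitaryGroup (Fin 3) ℂ))) :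
    ∫⁻ U, h₁ U ∂(wilsonMeasure (d := 4) (L := 2 * S + 1) (fundamentalRep (Fin 3)) β) ≤
      K * ∫⁻ U, h₂ U ∂(wilsonMeasure (d := 4) (L := 2 * S + 1) (fundamentalRep (Fin 3)) β) := by
  rw [lintegral_wilsonMeasure_eq β h₁ hh₁, lintegral_wilsonMeasure_eq β h₂ hh₂, mul_left_comm]
  exact mul_le_mul_right hle _

/-- The phase-quenched weight has finite `lintegral` against the Wilson measure. [folklore] -/
theorem lintegral_norm_det_diracMatrix_lt_top (β : ℝ) (mq : Fin Nf → ℝ) :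
    ∫⁻ U, ENNReal.ofReal ‖(diracMatrix U mq).det‖
        ∂(wilsonMeasure (d := 4) (L := 2 * S + 1) (fundamentalRep (Fin 3)) β) < ∞ :=
  (integrable_norm_det_diracMatrix mq _).lintegral_lt_top

/-- The phase-quenched denominator as a `lintegral`. [folklore] -/
theorem integral_norm_det_diracMatrix_eq_toReal (β : ℝ) (mq : Fin Nf → ℝ) :
    ∫ U, ‖(diracMatrix U mq).det‖ ∂(wilsonMeasure (d := 4) (L := 2 * S + 1) (fundamentalRep (Fin 3)) β) =
      (∫⁻ U, ENNReal.ofReal ‖(diracMatrix U mq).det‖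
        ∂(wilsonMeasure (d := 4) (L := 2 * S + 1) (fundamentalRep (Fin 3)) β)).toReal :=
  integral_eq_lintegral_of_nonneg_ae (ae_of_all _ fun _ => norm_nonneg _)
    (measurable_norm_det_diracMatrix mq).aestronglyMeasurable

/-- **`pqE F ≤ K` from a `lintegral` bound** `∫ |det 𝔇| F dμ_W ≤ K ∫ |det 𝔇| dμ_W` (`F ≥ 0` measurable). [folklore] -/
theorem pqE_le_of_lintegral_le (β : ℝ) (mq : Fin Nf → ℝ)
    (F : GaugeConfig 4 (2 * S + 1) (Matrix.specialUnitaryGroup (Fin 3) ℂ) → ℝ) (hF0 : ∀ U, 0 ≤ F U)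
    (hFm : Measurable F) {K : ℝ} (hK : 0 ≤ K)
    (h : ∫⁻ U, ENNReal.ofReal (‖(diracMatrix U mq).det‖ * F U)
          ∂(wilsonMeasure (d := 4) (L := 2 * S + 1) (fundamentalRep (Fin 3)) β) ≤
        ENNReal.ofReal K * ∫⁻ U, ENNReal.ofReal ‖(diracMatrix U mq).det‖
          ∂(wilsonMeasure (d := 4) (L := 2 * S + 1) (fundamentalRep (Fin 3)) β)) :
    pqE Nf S β mq F ≤ K := by
  have hden := integral_norm_det_diracMatrix_pos_all (S := 2 * S + 1) β mq
  unfold pqE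
  rw [div_le_iff₀ hden]
  have hnum : ∫ U, ‖(diracMatrix U mq).det‖ * F U
      ∂(wilsonMeasure (d := 4) (L := 2 * S + 1) (fundamentalRep (Fin 3)) β) =
      (∫⁻ U, ENNReal.ofReal (‖(diracMatrix U mq).det‖ * F U)
        ∂(wilsonMeasure (d := 4) (L := 2 * S + 1) (fundamentalRep (Fin 3)) β)).toReal :=
    integral_eq_lintegral_of_nonneg_ae (ae_of_all _ fun U => mul_nonneg (norm_nonneg _) (hF0 U))
      ((measurable_norm_det_diracMatrix mq).mul hFm).aestronglyMeasurable
  rw [hnum, integral_norm_det_diracMatrix_eq_toReal, ← ENNReal.toReal_ofReal hK, ← ENNReal.toReal_mul]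
  exact ENNReal.toReal_mono (ENNReal.mul_ne_top ENNReal.ofReal_ne_top
    (lintegral_norm_det_diracMatrix_lt_top β mq).ne) h

/-- **`pqE F ≤ Ξ · pqE G` from a `lintegral` bound** `∫ |det 𝔇| F dμ_W ≤ Ξ ∫ |det 𝔇| G dμ_W` (`F, G ≥ 0`
measurable, `|det 𝔇| G` integrable). [folklore] -/
theorem pqE_le_mul_pqE_of_lintegral_le (β : ℝ) (mq : Fin Nf → ℝ)
    (F G : GaugeConfig 4 (2 * S + 1) (Matrix.specialUnitaryGroup (Fin 3) ℂ) → ℝ) (hF0 : ∀ U, 0 ≤ F U)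
    (hG0 : ∀ U, 0 ≤ G U) (hFm : Measurable F) (hGm : Measurable G)
    (hGi : Integrable (fun U => ‖(diracMatrix U mq).det‖ * G U)
      (wilsonMeasure (d := 4) (L := 2 * S + 1) (fundamentalRep (Fin 3)) β))
    {Ξ : ℝ} (hΞ : 0 ≤ Ξ)
    (h : ∫⁻ U, ENNReal.ofReal (‖(diracMatrix U mq).det‖ * F U)
          ∂(wilsonMeasure (d := 4) (L := 2 * S + 1) (fundamentalRep (Fin 3)) β) ≤
        ENNReal.ofReal Ξ * ∫⁻ U, ENNReal.ofReal (‖(diracMatrix U mq).det‖ * G U)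
          ∂(wilsonMeasure (d := 4) (L := 2 * S + 1) (fundamentalRep (Fin 3)) β)) :
    pqE Nf S β mq F ≤ Ξ * pqE Nf S β mq G := by
  have hden := integral_norm_det_diracMatrix_pos_all (S := 2 * S + 1) β mq
  unfold pqE
  rw [← mul_div_assoc]
  refine div_le_div_of_nonneg_right ?_ hden.le
  have hnumF : ∫ U, ‖(diracMatrix U mq).det‖ * F U
      ∂(wilsonMeasure (d := 4) (L := 2 * S + 1) (fundamentalRep (Fin 3)) β) =
      (∫⁻ U, ENNReal.ofReal (‖(diracMatrix U mq).det‖ * F U)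
        ∂(wilsonMeasure (d := 4) (L := 2 * S + 1) (fundamentalRep (Fin 3)) β)).toReal :=
    integral_eq_lintegral_of_nonneg_ae (ae_of_all _ fun U => mul_nonneg (norm_nonneg _) (hF0 U))
      ((measurable_norm_det_diracMatrix mq).mul hFm).aestronglyMeasurable
  have hnumG : ∫ U, ‖(diracMatrix U mq).det‖ * G U
      ∂(wilsonMeasure (d := 4) (L := 2 * S + 1) (fundamentalRep (Fin 3)) β) =
      (∫⁻ U, ENNReal.ofReal (‖(diracMatrix U mq).det‖ * G U)
        ∂(wilsonMeasure (d := 4) (L := 2 * S + 1) (fundamentalRep (Fin 3)) β)).toReal :=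
    integral_eq_lintegral_of_nonneg_ae (ae_of_all _ fun U => mul_nonneg (norm_nonneg _) (hG0 U))
      ((measurable_norm_det_diracMatrix mq).mul hGm).aestronglyMeasurable
  rw [hnumF, hnumG, ← ENNReal.toReal_ofReal hΞ, ← ENNReal.toReal_mul]
  exact ENNReal.toReal_mono (ENNReal.mul_ne_top ENNReal.ofReal_ne_top hGi.lintegral_lt_top.ne) h

/-- **Integrability from a `lintegral` bound** against the (integrable) phase-quenched weight. [folklore] -/
theorem integrable_of_lintegral_le (β : ℝ) (mq : Fin Nf → ℝ)
    (F : GaugeConfig 4 (2 * S + 1) (Matrix.specialUnitaryGroup (Fin 3) ℂ) → ℝ) (hF0 : ∀ U, 0 ≤ F U)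
    (hFm : Measurable F) (K : ℝ≥0∞) (hK : K ≠ ∞)
    (h : ∫⁻ U, ENNReal.ofReal (‖(diracMatrix U mq).det‖ * F U)
          ∂(wilsonMeasure (d := 4) (L := 2 * S + 1) (fundamentalRep (Fin 3)) β) ≤
        K * ∫⁻ U, ENNReal.ofReal ‖(diracMatrix U mq).det‖
          ∂(wilsonMeasure (d := 4) (L := 2 * S + 1) (fundamentalRep (Fin 3)) β)) :
    Integrable (fun U => ‖(diracMatrix U mq).det‖ * F U)
      (wilsonMeasure (d := 4) (L := 2 * S + 1) (fundamentalRep (Fin 3)) β) := by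
  refine ⟨((measurable_norm_det_diracMatrix mq).mul hFm).aestronglyMeasurable, ?_⟩
  rw [hasFiniteIntegral_iff_ofReal (ae_of_all _ fun U => mul_nonneg (norm_nonneg _) (hF0 U))]
  exact lt_of_le_of_lt h (ENNReal.mul_lt_top hK.lt_top (lintegral_norm_det_diracMatrix_lt_top β mq))

/-- The fibre currency: the un-normalised phase-quenched weight `e^{-βS(V)} |det 𝔇(V)|` times `F`, as an
extended non-negative real; the factorised form used with `lintegral_wilsonMeasure_le_of_haar_le`. [folklore] -/
theorem ofReal_weight_mul (β : ℝ) (mq : Fin Nf → ℝ)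
    (F : GaugeConfig 4 (2 * S + 1) (Matrix.specialUnitaryGroup (Fin 3) ℂ) → ℝ)
    (V : GaugeConfig 4 (2 * S + 1) (Matrix.specialUnitaryGroup (Fin 3) ℂ)) :
    ENNReal.ofReal (Real.exp (-β * wilsonAction (fundamentalRep (Fin 3)) V)) *
        ENNReal.ofReal (‖(diracMatrix V mq).det‖ * F V) =
      ENNReal.ofReal (Real.exp (-(β * wilsonAction (fundamentalRep (Fin 3)) V)) * ‖(diracMatrix V mq).det‖ * F V) := by
  rw [← ENNReal.ofReal_mul (Real.exp_pos _).le, neg_mul, mul_assoc]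

/-- **`pqE F ≤ K` from a bound on every fibre.**  If on every fibre of the free links `R` (outside frozen to
`U`) `∫ e^{-βS}|det 𝔇| F ∘ refit ≤ K ∫ e^{-βS} |det 𝔇| ∘ refit` (product Haar), then `pqE F ≤ K`, and
`|det 𝔇| F` is `μ_W`-integrable. [folklore] -/
theorem pqE_le_of_fibre_bound (β : ℝ) (mq : Fin Nf → ℝ)
    (F : GaugeConfig 4 (2 * S + 1) (Matrix.specialUnitaryGroup (Fin 3) ℂ) → ℝ) (hF0 : ∀ U, 0 ≤ F U)
    (hFm : Measurable F) {K : ℝ} (hK : 0 ≤ K) (R : Finset (Edge 4 (2 * S + 1)))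
    (h : ∀ U : GaugeConfig 4 (2 * S + 1) (Matrix.specialUnitaryGroup (Fin 3) ℂ),
      ∫⁻ W, ENNReal.ofReal (Real.exp (-(β * wilsonAction (fundamentalRep (Fin 3))
            (fun e => if e ∈ R then W e else U e))) *
          ‖(diracMatrix (fun e => if e ∈ R then W e else U e) mq).det‖ *
          F (fun e => if e ∈ R then W e else U e))
        ∂(Measure.pi fun _ : Edge 4 (2 * S + 1) => haarProbability (Matrix.specialUnitaryGroup (Fin 3) ℂ)) ≤
      ENNReal.ofReal K * ∫⁻ W, ENNReal.ofReal (Real.exp (-(β * wilsonAction (fundamentalRep (Fin 3))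
            (fun e => if e ∈ R then W e else U e))) *
          ‖(diracMatrix (fun e => if e ∈ R then W e else U e) mq).det‖)
        ∂(Measure.pi fun _ : Edge 4 (2 * S + 1) => haarProbability (Matrix.specialUnitaryGroup (Fin 3) ℂ))) :
    pqE Nf S β mq F ≤ K ∧
      Integrable (fun U => ‖(diracMatrix U mq).det‖ * F U)
        (wilsonMeasure (d := 4) (L := 2 * S + 1) (fundamentalRep (Fin 3)) β) := by
  have hSm := measurable_wilsonAction (d := 4) (L := 2 * S + 1) (fundamentalRep (Fin 3))
    (continuous_fundamentalRep (Fin 3))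
  have hdm := measurable_norm_det_diracMatrix (S := 2 * S + 1) mq
  -- the two Haar integrands
  have hm₁ : Measurable fun V : GaugeConfig 4 (2 * S + 1) (Matrix.specialUnitaryGroup (Fin 3) ℂ) =>
      ENNReal.ofReal (Real.exp (-(β * wilsonAction (fundamentalRep (Fin 3)) V)) * ‖(diracMatrix V mq).det‖ * F V) :=
    (((Real.measurable_exp.comp (hSm.const_mul β).neg).mul hdm).mul hFm).ennreal_ofReal
  have hm₂ : Measurable fun V : GaugeConfig 4 (2 * S + 1) (Matrix.specialUnitaryGroup (Fin 3) ℂ) =>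
      ENNReal.ofReal (Real.exp (-(β * wilsonAction (fundamentalRep (Fin 3)) V)) * ‖(diracMatrix V mq).det‖) :=
    ((Real.measurable_exp.comp (hSm.const_mul β).neg).mul hdm).ennreal_ofReal
  have hglob := lintegral_le_of_forall_refit_le (haarProbability (Matrix.specialUnitaryGroup (Fin 3) ℂ)) R
    hm₁ hm₂ (ENNReal.ofReal K) h
  -- transfer to the Wilson measure
  have hW : ∫⁻ U, ENNReal.ofReal (‖(diracMatrix U mq).det‖ * F U)
        ∂(wilsonMeasure (d := 4) (L := 2 * S + 1) (fundamentalRep (Fin 3)) β) ≤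
      ENNReal.ofReal K * ∫⁻ U, ENNReal.ofReal ‖(diracMatrix U mq).det‖
        ∂(wilsonMeasure (d := 4) (L := 2 * S + 1) (fundamentalRep (Fin 3)) β) := by
    refine lintegral_wilsonMeasure_le_of_haar_le β
      (fun U => ENNReal.ofReal (‖(diracMatrix U mq).det‖ * F U))
      (fun U => ENNReal.ofReal ‖(diracMatrix U mq).det‖)
      ((hdm.mul hFm).ennreal_ofReal) hdm.ennreal_ofReal _ ?_
    have e₁ : (fun V : GaugeConfig 4 (2 * S + 1) (Matrix.specialUnitaryGroup (Fin 3) ℂ) =>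
        ENNReal.ofReal (Real.exp (-β * wilsonAction (fundamentalRep (Fin 3)) V)) *
          ENNReal.ofReal (‖(diracMatrix V mq).det‖ * F V)) =
        fun V => ENNReal.ofReal (Real.exp (-(β * wilsonAction (fundamentalRep (Fin 3)) V)) *
          ‖(diracMatrix V mq).det‖ * F V) := funext (ofReal_weight_mul β mq F)
    have e₂ : (fun V : GaugeConfig 4 (2 * S + 1) (Matrix.specialUnitaryGroup (Fin 3) ℂ) =>
        ENNReal.ofReal (Real.exp (-β * wilsonAction (fundamentalRep (Fin 3)) V)) *
          ENNReal.ofReal ‖(diracMatrix V mq).det‖) =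
        fun V => ENNReal.ofReal (Real.exp (-(β * wilsonAction (fundamentalRep (Fin 3)) V)) *
          ‖(diracMatrix V mq).det‖) := funext fun V => by
      rw [← ENNReal.ofReal_mul (Real.exp_pos _).le, neg_mul]
    have h1 := congrArg (fun φ : GaugeConfig 4 (2 * S + 1) (Matrix.specialUnitaryGroup (Fin 3) ℂ) → ℝ≥0∞ =>
      ∫⁻ V, φ V ∂(Measure.pi fun _ : Edge 4 (2 * S + 1) =>
        haarProbability (Matrix.specialUnitaryGroup (Fin 3) ℂ))) e₁
    have h2 := congrArg (fun φ : GaugeConfig 4 (2 * S + 1) (Matrix.specialUnitaryGroup (Fin 3) ℂ) → ℝ≥0∞ =>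
      ∫⁻ V, φ V ∂(Measure.pi fun _ : Edge 4 (2 * S + 1) =>
        haarProbability (Matrix.specialUnitaryGroup (Fin 3) ℂ))) e₂
    rw [h1, h2]
    exact hglob
  exact ⟨pqE_le_of_lintegral_le β mq F hF0 hFm hK hW,
    integrable_of_lintegral_le β mq F hF0 hFm _ ENNReal.ofReal_ne_top hW⟩

/-- **`pqE F ≤ Ξ · pqE G` from a bound on every fibre** (`|det 𝔇| G` integrable). [folklore] -/
theorem pqE_le_mul_pqE_of_fibre_bound (β : ℝ) (mq : Fin Nf → ℝ)
    (F G : GaugeConfig 4 (2 * S + 1) (Matrix.specialUnitaryGroup (Fin 3) ℂ) → ℝ) (hF0 : ∀ U, 0 ≤ F U)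
    (hG0 : ∀ U, 0 ≤ G U) (hFm : Measurable F) (hGm : Measurable G)
    (hGi : Integrable (fun U => ‖(diracMatrix U mq).det‖ * G U)
      (wilsonMeasure (d := 4) (L := 2 * S + 1) (fundamentalRep (Fin 3)) β))
    {Ξ : ℝ} (hΞ : 0 ≤ Ξ) (R : Finset (Edge 4 (2 * S + 1)))
    (h : ∀ U : GaugeConfig 4 (2 * S + 1) (Matrix.specialUnitaryGroup (Fin 3) ℂ),
      ∫⁻ W, ENNReal.ofReal (Real.exp (-(β * wilsonAction (fundamentalRep (Fin 3))
            (fun e => if e ∈ R then W e else U e))) *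
          ‖(diracMatrix (fun e => if e ∈ R then W e else U e) mq).det‖ *
          F (fun e => if e ∈ R then W e else U e))
        ∂(Measure.pi fun _ : Edge 4 (2 * S + 1) => haarProbability (Matrix.specialUnitaryGroup (Fin 3) ℂ)) ≤
      ENNReal.ofReal Ξ * ∫⁻ W, ENNReal.ofReal (Real.exp (-(β * wilsonAction (fundamentalRep (Fin 3))
            (fun e => if e ∈ R then W e else U e))) *
          ‖(diracMatrix (fun e => if e ∈ R then W e else U e) mq).det‖ *
          G (fun e => if e ∈ R then W e else U e))
        ∂(Measure.pi fun _ : Edge 4 (2 * S + 1) => haarProbability (Matrix.specialUnitaryGroup (Fin 3) ℂ))) :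
    pqE Nf S β mq F ≤ Ξ * pqE Nf S β mq G := by
  have hSm := measurable_wilsonAction (d := 4) (L := 2 * S + 1) (fundamentalRep (Fin 3))
    (continuous_fundamentalRep (Fin 3))
  have hdm := measurable_norm_det_diracMatrix (S := 2 * S + 1) mq
  have hm₁ : Measurable fun V : GaugeConfig 4 (2 * S + 1) (Matrix.specialUnitaryGroup (Fin 3) ℂ) =>
      ENNReal.ofReal (Real.exp (-(β * wilsonAction (fundamentalRep (Fin 3)) V)) * ‖(diracMatrix V mq).det‖ * F V) :=
    (((Real.measurable_exp.comp (hSm.const_mul β).neg).mul hdm).mul hFm).ennreal_ofReal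
  have hm₂ : Measurable fun V : GaugeConfig 4 (2 * S + 1) (Matrix.specialUnitaryGroup (Fin 3) ℂ) =>
      ENNReal.ofReal (Real.exp (-(β * wilsonAction (fundamentalRep (Fin 3)) V)) * ‖(diracMatrix V mq).det‖ * G V) :=
    (((Real.measurable_exp.comp (hSm.const_mul β).neg).mul hdm).mul hGm).ennreal_ofReal
  have hglob := lintegral_le_of_forall_refit_le (haarProbability (Matrix.specialUnitaryGroup (Fin 3) ℂ)) R
    hm₁ hm₂ (ENNReal.ofReal Ξ) h
  have hW : ∫⁻ U, ENNReal.ofReal (‖(diracMatrix U mq).det‖ * F U)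
        ∂(wilsonMeasure (d := 4) (L := 2 * S + 1) (fundamentalRep (Fin 3)) β) ≤
      ENNReal.ofReal Ξ * ∫⁻ U, ENNReal.ofReal (‖(diracMatrix U mq).det‖ * G U)
        ∂(wilsonMeasure (d := 4) (L := 2 * S + 1) (fundamentalRep (Fin 3)) β) := by
    refine lintegral_wilsonMeasure_le_of_haar_le β
      (fun U => ENNReal.ofReal (‖(diracMatrix U mq).det‖ * F U))
      (fun U => ENNReal.ofReal (‖(diracMatrix U mq).det‖ * G U))
      ((hdm.mul hFm).ennreal_ofReal) ((hdm.mul hGm).ennreal_ofReal) _ ?_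
    have h1 := congrArg (fun φ : GaugeConfig 4 (2 * S + 1) (Matrix.specialUnitaryGroup (Fin 3) ℂ) → ℝ≥0∞ =>
      ∫⁻ V, φ V ∂(Measure.pi fun _ : Edge 4 (2 * S + 1) =>
        haarProbability (Matrix.specialUnitaryGroup (Fin 3) ℂ))) (funext (ofReal_weight_mul β mq F))
    have h2 := congrArg (fun φ : GaugeConfig 4 (2 * S + 1) (Matrix.specialUnitaryGroup (Fin 3) ℂ) → ℝ≥0∞ =>
      ∫⁻ V, φ V ∂(Measure.pi fun _ : Edge 4 (2 * S + 1) =>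
        haarProbability (Matrix.specialUnitaryGroup (Fin 3) ℂ))) (funext (ofReal_weight_mul β mq G))
    rw [h1, h2]
    exact hglob
  exact pqE_le_mul_pqE_of_lintegral_le β mq F G hF0 hG0 hFm hGm hGi hΞ hW

end Wilson

/-- **Registered helper `stub_twoStar_aux3` of crux stmt-QuantumFields-11512** (line `von-mises-circles`, stub
`stub_twoStar`): a fibrewise bound `∫ e^{-βS}|det 𝔇| F ≤ K ∫ e^{-βS}|det 𝔇|` on every fibre of free links `R`
(outside frozen) gives `pqE F ≤ K` and the integrability of `|det 𝔇| F` — the conditioning step of clauses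
(T0), (T5) of `TwoStarBounds`. [folklore] -/
theorem stub_twoStar_aux3 : ∀ (Nf S : ℕ) (β : ℝ) (mq : Fin Nf → ℝ) (F : GaugeConfig 4 (2 * S + 1) (Matrix.specialUnitaryGroup (Fin 3) ℂ) → ℝ), (∀ U, 0 ≤ F U) → Measurable F → ∀ (K : ℝ), 0 ≤ K → ∀ (R : Finset (Edge 4 (2 * S + 1))), (∀ U : GaugeConfig 4 (2 * S + 1) (Matrix.specialUnitaryGroup (Fin 3) ℂ), ∫⁻ W, ENNReal.ofReal (Real.exp (-(β * wilsonAction (fundamentalRep (Fin 3)) (fun e => if e ∈ R then W e else U e))) * ‖(diracMatrix (fun e => if e ∈ R then W e else U e) mq).det‖ * F (fun e => if e ∈ R then W e else U e)) ∂(Measure.pi fun _ : Edge 4 (2 * S + 1) => haarProbability (Matrix.specialUnitaryGroup (Fin 3) ℂ)) ≤ ENNReal.ofReal K * ∫⁻ W, ENNReal.ofReal (Real.exp (-(β * wilsonAction (fundamentalRep (Fin 3)) (fun e => if e ∈ R then W e else U e))) * ‖(diracMatrix (fun e => if e ∈ R then W e else U e) mq).det‖) ∂(Measure.pi fun _ :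 Edge 4 (2 * S + 1) => haarProbability (Matrix.specialUnitaryGroup (Fin 3) ℂ))) → pqE Nf S β mq F ≤ K ∧ Integrable (fun U => ‖(diracMatrix U mq).det‖ * F U) (wilsonMeasure (fundamentalRep (Fin 3)) β) :=
  fun _ _ β mq F hF0 hFm _ hK R h => pqE_le_of_fibre_bound β mq F hF0 hFm hK R h

end Summit.QuantumFields.QCD.Theorems.VonMisesCirclesC1
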